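import Literature.Analysis.FluidPDE.PlanarPolarCoords
import Literature.Analysis.FluidPDE.BiotSavart2DSymmetry
import Literature.Analysis.FluidPDE.GaussianVortexPlanarProofs
import HarnessLib

/-!
# Angular Fourier modes of the radial Biot–Savart velocity

Support file (everything proved, `[folklore]`) for the proof of Maekawa's kernel lemma
(`Literature.Analysis.FluidPDE.GallayMaekawa2016_lem27_classical`, Gallay–Maekawa 2016,
Lemma 2.7). For the planar Biot–Savart law `v = K ∗ w`, `K(x) = x^⊥/(2π|x|²)`
(`biotSavart2D`, `biotSavartKernel2D` of `GaussianVortexPlanar`) and a continuous integrable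
vorticity `w`, the angular Fourier coefficients (`angCoeff` of `PlanarPolarCoords`) of the radial
velocity `ξ · v(ξ)` on the circle `|ξ| = r` are computed mode by mode:

  `(2π)⁻¹ ∫_{-π}^{π} e^{-inθ} ⟪v(ξ_θ), ξ_θ⟫ dθ = (i/2) ∫_0^∞ ρ (min(r,ρ)/max(r,ρ))^n ŵ_n(ρ) dρ`,
  `n ≥ 1`, `ξ_θ = (r cos θ, r sin θ)` (`angCoeff_inner_biotSavart2D`).

This is the classical multipole expansion of the planar Biot–Savart kernel,
`ξ·(ξ−η)^⊥/|ξ−η|² = −Σ_{m≥1} t^m sin m(θ−φ)`, `t = min/max` of `|ξ|, |η|`, written so that no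
series, stream function or distributional Poisson equation is needed:

* the **kernel in complex form**: with `z_ξ = ξ₀ + iξ₁`, `u = z_ξ z̄_η / max(r,|η|)²` (`|u| < 1`
  off the circle `|η| = r`), `⟪K(ξ−η), ξ⟫ = −(2π)⁻¹ Im (u/(1−u))` (`inner_biotSavartKernel2D_eq_im`);
* the **θ-integral for a fixed source point `η`** by a FINITE geometric sum plus a remainder
  `u^{N+1}/(1−u)` that is `O(t^{N+1})`: `∫ e^{-inθ} ⟪K(ξ_θ−η), ξ_θ⟫ dθ = −c(η)^n/(2i)`,
  `c(η) = r z̄_η / max(r,|η|)²` (`integral_angExp_mul_inner_kernel`);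
* **Fubini** on `(−π, π] × ℝ²` (the inner `L¹` norms are bounded uniformly on the circle because
  `w` is bounded on `closedBall 0 (r+1)` and integrable, and `|x|⁻¹ ∈ L¹_loc(ℝ²)`), the null circle
  `|η| = r` (`Measure.addHaar_sphere`), and **polar coordinates** in `η`
  (`integral_eq_integral_circlePt`), where `c(ρe^{iφ})^n = t^n e^{-inφ}`.

## References

* Th. Gallay, Y. Maekawa, *Existence and stability of viscous vortices*, arXiv:1610.08384, §2.1
  (the computation of `ξ · v` after (2.12)), §2.2, Lemma 2.7. [GallayMaekawa2016]
-/

noncomputable section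

open Set Function Filter MeasureTheory WithLp Complex Metric
open scoped Real Topology InnerProductSpace RealInnerProductSpace ComplexConjugate Interval

namespace Literature.Analysis.FluidPDE

/-- Local notation for the plane `ℝ² = EuclideanSpace ℝ (Fin 2)`. -/
local notation "ℝ²" => EuclideanSpace ℝ (Fin 2)

/-! ### The kernel in complex form -/

/-- The complex identity behind the multipole expansion: for `|z| = r > 0`, `|w| ≠ r` and
`u = z w̄ / max(r,|w|)²` one has `Im (u/(1−u)) = Im (z w̄)/|z − w|²`. [folklore] -/
theorem im_div_one_sub_eq {z w : ℂ} {r : ℝ} (hr : 0 < r) (hz : ‖z‖ = r) (hw : ‖w‖ ≠ r) :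
    (z * conj w / ((max r ‖w‖ : ℝ) : ℂ) ^ 2 / (1 - z * conj w / ((max r ‖w‖ : ℝ) : ℂ) ^ 2)).im =
      (z * conj w).im / Complex.normSq (z - w) := by
  have hzw : z - w ≠ 0 := by
    intro h; apply hw; rw [← hz, sub_eq_zero.1 h]
  have hN : (Complex.normSq (z - w) : ℂ) ≠ 0 := by
    exact_mod_cast (Complex.normSq_pos.2 hzw).ne'
  have hNeq : (Complex.normSq (z - w) : ℂ) = (z - w) * (conj z - conj w) := by
    rw [← map_sub, Complex.mul_conj]
  have hz0 : z ≠ 0 := by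
    intro h; rw [h, norm_zero] at hz; exact hr.ne' hz.symm
  have hzz : z * conj z = ((r : ℝ) : ℂ) ^ 2 := by
    rw [Complex.mul_conj, Complex.normSq_eq_norm_sq, hz]; push_cast; ring
  rcases lt_or_gt_of_ne hw with hlt | hgt
  · -- `|w| < r`: `u = z w̄ / r²`, `u/(1-u) = w̄ (z - w)/|z - w|²`
    rw [max_eq_left hlt.le]
    have hu1 : 1 - z * conj w / ((r : ℝ) : ℂ) ^ 2 ≠ 0 := by
      intro h
      have h1 : z * conj w / ((r : ℝ) : ℂ) ^ 2 = 1 := (sub_eq_zero.1 h).symm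
      have : ‖z * conj w / ((r : ℝ) : ℂ) ^ 2‖ < 1 := by
        rw [norm_div, norm_mul, Complex.norm_conj, norm_pow, Complex.norm_real,
          Real.norm_of_nonneg hr.le, hz, div_lt_one (by positivity)]
        nlinarith [norm_nonneg w]
      rw [h1, norm_one] at this
      exact lt_irrefl _ this
    have hr2 : ((r : ℝ) : ℂ) ^ 2 ≠ 0 := by exact_mod_cast (pow_pos hr 2).ne'
    have key : z * conj w / ((r : ℝ) : ℂ) ^ 2 / (1 - z * conj w / ((r : ℝ) : ℂ) ^ 2) =
        conj w * (z - w) / (Complex.normSq (z - w) : ℂ) := by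
      rw [div_eq_div_iff hu1 hN, hNeq]
      have hr0 : ((r : ℝ) : ℂ) ≠ 0 := by exact_mod_cast hr.ne'
      have hcz : conj z = ((r : ℝ) : ℂ) ^ 2 / z := by
        rw [← hzz]; field_simp
      rw [hcz]
      field_simp
    rw [key, Complex.div_ofReal_im]
    congr 1
    simp only [Complex.mul_im, Complex.sub_re, Complex.sub_im, Complex.conj_re, Complex.conj_im]
    ring
  · -- `|w| > r`: `u = z / w`, `u/(1-u) = z (w̄ - z̄)/|z - w|²`
    rw [max_eq_right hgt.le]
    have hw0 : w ≠ 0 := by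
      intro h; rw [h, norm_zero] at hgt; exact lt_irrefl _ (hr.trans hgt)
    have hww : ((‖w‖ : ℝ) : ℂ) ^ 2 = w * conj w := by
      rw [Complex.mul_conj, Complex.normSq_eq_norm_sq]; push_cast; ring
    have hu : z * conj w / ((‖w‖ : ℝ) : ℂ) ^ 2 = z / w := by
      rw [hww]
      have : conj w ≠ 0 := (map_ne_zero _).2 hw0
      field_simp
    rw [hu]
    have hu1 : 1 - z / w ≠ 0 := by
      intro h
      have h1 : z / w = 1 := (sub_eq_zero.1 h).symm
      have : ‖z / w‖ < 1 := by
        rw [norm_div, hz, div_lt_one (hr.trans hgt)]; exact hgt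
      rw [h1, norm_one] at this
      exact lt_irrefl _ this
    have key : z / w / (1 - z / w) = z * (conj w - conj z) / (Complex.normSq (z - w) : ℂ) := by
      rw [div_eq_div_iff hu1 hN, hNeq]
      field_simp
      ring
    rw [key, Complex.div_ofReal_im]
    congr 1
    simp only [Complex.mul_im, Complex.sub_re, Complex.sub_im, Complex.conj_re, Complex.conj_im]
    ring

/-- The multipole parameter `c(η) = r z̄_η / max(r,|η|)²` of a source point `η` seen from the
circle of radius `r` (so that `u = c(η) e^{iθ}` at the field point `ξ_θ`). [folklore] -/
def kerParam (r : ℝ) (η : ℝ²) : ℂ :=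
  (r : ℂ) * conj (cplx η) / ((max r ‖η‖ : ℝ) : ℂ) ^ 2

/-- `|c(η)| = r|η|/max(r,|η|)²`. [folklore] -/
theorem norm_kerParam {r : ℝ} (hr : 0 < r) (η : ℝ²) :
    ‖kerParam r η‖ = r * ‖η‖ / max r ‖η‖ ^ 2 := by
  rw [kerParam, norm_div, norm_mul, Complex.norm_conj, norm_cplx, norm_pow, Complex.norm_real,
    Complex.norm_real, Real.norm_of_nonneg hr.le,
    Real.norm_of_nonneg (hr.le.trans (le_max_left _ _))]

/-- `r|η|/max(r,|η|)² = min(r,|η|)/max(r,|η|)`. [folklore] -/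
theorem mul_div_max_sq_eq_min_div_max {r : ℝ} (hr : 0 < r) (ρ : ℝ) :
    r * ρ / max r ρ ^ 2 = min r ρ / max r ρ := by
  rcases le_total r ρ with h | h
  · rw [max_eq_right h, min_eq_left h]
    have : ρ ≠ 0 := by intro h0; rw [h0] at h; exact (not_le.2 hr) h
    field_simp
  · rw [max_eq_left h, min_eq_right h]
    field_simp

/-- `|c(η)| ≤ 1`. [folklore] -/
theorem norm_kerParam_le_one {r : ℝ} (hr : 0 < r) (η : ℝ²) : ‖kerParam r η‖ ≤ 1 := by
  rw [norm_kerParam hr, mul_div_max_sq_eq_min_div_max hr ‖η‖,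
    div_le_one (lt_of_lt_of_le hr (le_max_left _ _))]
  exact min_le_max

/-- Off the circle `|η| = r` the parameter is strictly inside the unit disc: `|c(η)| < 1`.
[folklore] -/
theorem norm_kerParam_lt_one {r : ℝ} (hr : 0 < r) {η : ℝ²} (hη : ‖η‖ ≠ r) :
    ‖kerParam r η‖ < 1 := by
  rw [norm_kerParam hr, mul_div_max_sq_eq_min_div_max hr ‖η‖,
    div_lt_one (lt_of_lt_of_le hr (le_max_left _ _))]
  rcases lt_or_gt_of_ne hη with h | h
  · rw [min_eq_right h.le, max_eq_left h.le]; exact h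
  · rw [min_eq_left h.le, max_eq_right h.le]; exact h

/-- `c` is continuous in the source point (for `r > 0`). [folklore] -/
theorem continuous_kerParam {r : ℝ} (hr : 0 < r) : Continuous (kerParam r) := by
  unfold kerParam
  refine Continuous.div (continuous_const.mul (Complex.continuous_conj.comp continuous_cplx))
    ((Complex.continuous_ofReal.comp (continuous_const.max continuous_norm)).pow 2) fun η => ?_
  exact pow_ne_zero _ (by exact_mod_cast (lt_of_lt_of_le hr (le_max_left r ‖η‖)).ne')

/-- **The planar Biot–Savart kernel in complex form.** For `ξ = (r cos θ, r sin θ)`, `r > 0`,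
and a source point `η` with `|η| ≠ r`: `⟪K(ξ − η), ξ⟫ = −(2π)⁻¹ Im (u/(1−u))`,
`u = c(η) e^{iθ}`. [folklore] -/
theorem inner_biotSavartKernel2D_eq_im {r : ℝ} (hr : 0 < r) (θ : ℝ) {η : ℝ²} (hη : ‖η‖ ≠ r) :
    ⟪biotSavartKernel2D (circlePt r θ - η), circlePt r θ⟫ =
      -(2 * π)⁻¹ * (kerParam r η * angExp 1 θ / (1 - kerParam r η * angExp 1 θ)).im := by
  have hz : ‖cplx (circlePt r θ)‖ = r := by rw [norm_cplx, norm_circlePt, abs_of_pos hr]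
  have hw : ‖cplx η‖ ≠ r := by rwa [norm_cplx]
  have hu : kerParam r η * angExp 1 θ =
      cplx (circlePt r θ) * conj (cplx η) / ((max r ‖cplx η‖ : ℝ) : ℂ) ^ 2 := by
    rw [kerParam, cplx_circlePt_eq_angExp, norm_cplx]; ring
  rw [hu, im_div_one_sub_eq hr hz hw, biotSavartKernel2D, real_inner_smul_left, perp_sub,
    inner_sub_left, inner_perp_self_left, zero_sub, inner_perp_left_eq_im,
    ← norm_cplx (circlePt r θ - η), cplx_sub, Complex.normSq_eq_norm_sq]
  ring

/-! ### The `θ`-integral for a fixed source point -/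

/-- `e_s^k = e_{ks}`. [folklore] -/
theorem angExp_pow (s : ℤ) (k : ℕ) (θ : ℝ) : angExp s θ ^ k = angExp (k * s) θ := by
  induction k with
  | zero => simp
  | succ k ih => rw [pow_succ, ih, show ((k + 1 : ℕ) : ℤ) * s = (k : ℤ) * s + s by push_cast; ring,
      angExp_add]

/-- The finite geometric decomposition `u/(1−u) = Σ_{k<N} u^{k+1} + u^{N+1}/(1−u)`. [folklore] -/
theorem div_one_sub_eq_sum_add {u : ℂ} (hu : u ≠ 1) (N : ℕ) :
    u / (1 - u) = (∑ k ∈ Finset.range N, u ^ (k + 1)) + u ^ (N + 1) / (1 - u) := by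
  have h1 : (1 - u) ≠ 0 := sub_ne_zero.2 (Ne.symm hu)
  have hgeom : (∑ k ∈ Finset.range N, u ^ (k + 1)) * (1 - u) = u - u ^ (N + 1) := by
    have := geom_sum_mul u N
    simp_rw [pow_succ]
    rw [← Finset.sum_mul]
    linear_combination -u * this
  rw [(eq_div_iff h1).2 hgeom, ← add_div]
  congr 1
  ring

/-- **Generating-function integrals on a full turn.** For `|a| < 1`, `s ∈ ℤ`, `n ∈ ℤ` and every
`N`, `∫_{-π}^{π} e^{-inθ} (a e^{isθ})/(1 − a e^{isθ}) dθ` equals the finite sum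
`Σ_{k<N} a^{k+1} · 2π[s(k+1) = n]` up to an error of norm `≤ 2π |a|^{N+1}/(1 − |a|)`. [folklore] -/
theorem norm_integral_geom_sub_sum_le {a : ℂ} (ha : ‖a‖ < 1) (s n : ℤ) (N : ℕ) :
    ‖(∫ θ in (-π)..π, angExp (-n) θ * (a * angExp s θ / (1 - a * angExp s θ))) -
        ∑ k ∈ Finset.range N, a ^ (k + 1) * (if s * (k + 1 : ℕ) = n then (2 * π : ℂ) else 0)‖ ≤
      2 * π * (‖a‖ ^ (N + 1) / (1 - ‖a‖)) := by
  have hπ : -π ≤ π := by linarith [Real.pi_pos]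
  have hu1 : ∀ θ : ℝ, a * angExp s θ ≠ 1 := fun θ h => by
    have : ‖a * angExp s θ‖ = 1 := by rw [h, norm_one]
    rw [norm_mul, norm_angExp, mul_one] at this
    exact (lt_irrefl _ (this ▸ ha))
  have hcu : Continuous fun θ : ℝ => a * angExp s θ := continuous_const.mul (continuous_angExp s)
  have hc1 : Continuous fun θ : ℝ => 1 - a * angExp s θ := continuous_const.sub hcu
  have hne : ∀ θ : ℝ, 1 - a * angExp s θ ≠ 0 := fun θ => sub_ne_zero.2 (Ne.symm (hu1 θ))
  -- pointwise decomposition of the integrand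
  have hdec : ∀ θ : ℝ, angExp (-n) θ * (a * angExp s θ / (1 - a * angExp s θ)) =
      (∑ k ∈ Finset.range N, a ^ (k + 1) * (angExp (-n) θ * angExp (s * (k + 1 : ℕ)) θ)) +
        angExp (-n) θ * ((a * angExp s θ) ^ (N + 1) / (1 - a * angExp s θ)) := by
    intro θ
    rw [div_one_sub_eq_sum_add (hu1 θ) N, mul_add, Finset.mul_sum]
    congr 1
    refine Finset.sum_congr rfl fun k _ => ?_
    rw [mul_pow, show s * ((k + 1 : ℕ) : ℤ) = ((k + 1 : ℕ) : ℤ) * s by ring, ← angExp_pow s (k + 1) θ]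
    ring
  -- integrability of the pieces (all continuous)
  have hck : ∀ k : ℕ, Continuous fun θ : ℝ =>
      a ^ (k + 1) * (angExp (-n) θ * angExp (s * (k + 1 : ℕ)) θ) := fun k =>
    continuous_const.mul ((continuous_angExp _).mul (continuous_angExp _))
  have hcR : Continuous fun θ : ℝ =>
      angExp (-n) θ * ((a * angExp s θ) ^ (N + 1) / (1 - a * angExp s θ)) :=
    (continuous_angExp _).mul ((hcu.pow _).div hc1 hne)
  have horth : ∀ k : ℕ, ∫ θ in (-π)..π, a ^ (k + 1) * (angExp (-n) θ * angExp (s * (k + 1 : ℕ)) θ) =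
      a ^ (k + 1) * (if s * (k + 1 : ℕ) = n then (2 * π : ℂ) else 0) := by
    intro k
    rw [intervalIntegral.integral_const_mul]
    congr 1
    have h := integral_angExp_neg_mul_angExp (s * (k + 1 : ℕ)) n
    have hπ0 : (2 * π : ℂ) ≠ 0 := by exact_mod_cast Real.two_pi_pos.ne'
    rw [inv_mul_eq_iff_eq_mul₀ hπ0] at h
    rw [h]
    split_ifs <;> simp
  have hsplit : (∫ θ in (-π)..π, angExp (-n) θ * (a * angExp s θ / (1 - a * angExp s θ))) =
      (∑ k ∈ Finset.range N, a ^ (k + 1) * (if s * (k + 1 : ℕ) = n then (2 * π : ℂ) else 0)) +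
        ∫ θ in (-π)..π, angExp (-n) θ * ((a * angExp s θ) ^ (N + 1) / (1 - a * angExp s θ)) := by
    rw [intervalIntegral.integral_congr (fun θ _ => hdec θ), intervalIntegral.integral_add
      ((continuous_finsetSum _ fun k _ => hck k).intervalIntegrable _ _) (hcR.intervalIntegrable _ _),
      intervalIntegral.integral_finsetSum (fun k _ => (hck k).intervalIntegrable _ _)]
    simp_rw [horth]
  rw [hsplit, add_sub_cancel_left]
  -- the remainder
  have ht1 : 0 < 1 - ‖a‖ := by linarith
  have hbound : ∀ θ ∈ Ι (-π) π, ‖angExp (-n) θ * ((a * angExp s θ) ^ (N + 1) / (1 - a * angExp s θ))‖ ≤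
      ‖a‖ ^ (N + 1) / (1 - ‖a‖) := by
    intro θ _
    rw [norm_mul, norm_angExp, one_mul, norm_div, norm_pow, norm_mul, norm_angExp, mul_one]
    gcongr
    calc 1 - ‖a‖ = ‖(1 : ℂ)‖ - ‖a * angExp s θ‖ := by rw [norm_one, norm_mul, norm_angExp, mul_one]
      _ ≤ ‖1 - a * angExp s θ‖ := norm_sub_norm_le _ _
  refine (intervalIntegral.norm_integral_le_of_norm_le_const hbound).trans (le_of_eq ?_)
  rw [show |π - -π| = 2 * π by rw [abs_of_nonneg (by linarith [Real.pi_pos])]; ring]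
  ring

/-- `Im z` as a complex number: `(Im z : ℂ) = (z − z̄)/(2i)`. [folklore] -/
theorem ofReal_im_eq_sub_conj_div (z : ℂ) : ((z.im : ℝ) : ℂ) = (z - conj z) / (2 * I) := by
  rw [Complex.sub_conj]
  have : (2 : ℂ) * I ≠ 0 := mul_ne_zero two_ne_zero Complex.I_ne_zero
  field_simp
  push_cast
  ring

/-- **The `θ`-integral of the kernel against `e^{-inθ}` for a fixed source point.** For `r > 0`,
`|η| ≠ r` and `n ≥ 1`: `∫_{-π}^{π} e^{-inθ} ⟪K(ξ_θ − η), ξ_θ⟫ dθ = −c(η)^n/(2i)`,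
`ξ_θ = (r cos θ, r sin θ)`, `c(η) = r z̄_η/max(r,|η|)²` — the `n`-th Fourier coefficient of
`θ ↦ −(2π)⁻¹ Σ_{m≥1} Im (c(η)^m e^{imθ})`, obtained from the finite geometric sum and the
remainder estimate `norm_integral_geom_sub_sum_le` by letting `N → ∞`. [folklore] -/
theorem integral_angExp_mul_inner_kernel {r : ℝ} (hr : 0 < r) {η : ℝ²} (hη : ‖η‖ ≠ r) {n : ℕ}
    (hn : 1 ≤ n) :
    ∫ θ in (-π)..π, angExp (-n) θ *
        (⟪biotSavartKernel2D (circlePt r θ - η), circlePt r θ⟫ : ℂ) =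
      -(kerParam r η) ^ n / (2 * I) := by
  set c := kerParam r η with hc_def
  have hc : ‖c‖ < 1 := norm_kerParam_lt_one hr hη
  have hcc : ‖conj c‖ < 1 := by rwa [Complex.norm_conj]
  have h2I : (2 : ℂ) * I ≠ 0 := mul_ne_zero two_ne_zero Complex.I_ne_zero
  have hπ0 : (2 * π : ℂ) ≠ 0 := by exact_mod_cast Real.two_pi_pos.ne'
  -- the integrand in complex form
  set F : ℝ → ℂ := fun θ => c * angExp 1 θ / (1 - c * angExp 1 θ) with hF
  set G : ℝ → ℂ := fun θ => conj c * angExp (-1) θ / (1 - conj c * angExp (-1) θ) with hG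
  have hpt : ∀ θ : ℝ, (⟪biotSavartKernel2D (circlePt r θ - η), circlePt r θ⟫ : ℂ) =
      -(2 * π : ℂ)⁻¹ * ((F θ - G θ) / (2 * I)) := by
    intro θ
    rw [inner_biotSavartKernel2D_eq_im hr θ hη]
    push_cast
    rw [ofReal_im_eq_sub_conj_div, map_div₀, map_sub, map_one, map_mul, ← angExp_neg]
  have hne1 : ∀ (a : ℂ) (s : ℤ), ‖a‖ < 1 → ∀ θ : ℝ, 1 - a * angExp s θ ≠ 0 := fun a s ha θ h => by
    have : ‖a * angExp s θ‖ = 1 := by rw [← (sub_eq_zero.1 h), norm_one]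
    rw [norm_mul, norm_angExp, mul_one] at this
    exact lt_irrefl _ (this ▸ ha)
  have hFc : Continuous F := (continuous_const.mul (continuous_angExp 1)).div
    (continuous_const.sub (continuous_const.mul (continuous_angExp 1))) (hne1 c 1 hc)
  have hGc : Continuous G := (continuous_const.mul (continuous_angExp (-1))).div
    (continuous_const.sub (continuous_const.mul (continuous_angExp (-1)))) (hne1 (conj c) (-1) hcc)
  set A := ∫ θ in (-π)..π, angExp (-n) θ * F θ with hA
  set B := ∫ θ in (-π)..π, angExp (-n) θ * G θ with hB
  have hsplit : (∫ θ in (-π)..π, angExp (-n) θ *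
      (⟪biotSavartKernel2D (circlePt r θ - η), circlePt r θ⟫ : ℂ)) =
      -(2 * π : ℂ)⁻¹ * ((A - B) / (2 * I)) := by
    simp_rw [hpt]
    have : ∀ θ : ℝ, angExp (-n) θ * (-(2 * π : ℂ)⁻¹ * ((F θ - G θ) / (2 * I))) =
        (-(2 * π : ℂ)⁻¹ / (2 * I)) * (angExp (-n) θ * F θ - angExp (-n) θ * G θ) := by
      intro θ; ring
    simp_rw [this]
    have h1 : IntervalIntegrable (fun θ : ℝ => angExp (-n) θ * F θ) volume (-π) π :=
      ((continuous_angExp _).mul hFc).intervalIntegrable _ _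
    have h2 : IntervalIntegrable (fun θ : ℝ => angExp (-n) θ * G θ) volume (-π) π :=
      ((continuous_angExp _).mul hGc).intervalIntegrable _ _
    have hAB : (∫ θ in (-π)..π, (angExp (-n) θ * F θ - angExp (-n) θ * G θ)) = A - B :=
      intervalIntegral.integral_sub h1 h2
    rw [intervalIntegral.integral_const_mul, hAB]
    ring
  rw [hsplit]
  -- the finite sums: `2π c^n` for `F`, `0` for `G`
  have hsumF : ∀ N : ℕ, n ≤ N → ∑ k ∈ Finset.range N, c ^ (k + 1) *
      (if (1 : ℤ) * (k + 1 : ℕ) = n then (2 * π : ℂ) else 0) = 2 * π * c ^ n := by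
    intro N hN
    rw [Finset.sum_eq_single (n - 1)]
    · rw [one_mul, if_pos (by push_cast; omega), show n - 1 + 1 = n by omega]; ring
    · intro k _ hk
      rw [one_mul, if_neg (by push_cast; omega), mul_zero]
    · intro h
      exfalso; exact h (Finset.mem_range.2 (by omega))
  have hsumG : ∀ N : ℕ, ∑ k ∈ Finset.range N, conj c ^ (k + 1) *
      (if (-1 : ℤ) * (k + 1 : ℕ) = n then (2 * π : ℂ) else 0) = 0 := by
    intro N
    refine Finset.sum_eq_zero fun k _ => ?_
    rw [if_neg (by push_cast; omega), mul_zero]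
  -- error bounds for every `N ≥ n`
  have hbound : ∀ N : ℕ, n ≤ N →
      ‖-(2 * π : ℂ)⁻¹ * ((A - B) / (2 * I)) - -(c ^ n) / (2 * I)‖ ≤
        ‖c‖ ^ (N + 1) / (1 - ‖c‖) := by
    intro N hN
    have hA' := norm_integral_geom_sub_sum_le hc 1 n N
    have hB' := norm_integral_geom_sub_sum_le hcc (-1) n N
    rw [hsumF N hN] at hA'
    rw [hsumG N, sub_zero] at hB'
    rw [Complex.norm_conj] at hB'
    have heq : -(2 * π : ℂ)⁻¹ * ((A - B) / (2 * I)) - -(c ^ n) / (2 * I) =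
        (-(2 * π : ℂ)⁻¹ / (2 * I)) * ((A - 2 * π * c ^ n) - B) := by
      field_simp; ring
    have hnorm : ‖(-(2 * π : ℂ)⁻¹ / (2 * I))‖ = (2 * π)⁻¹ / 2 := by
      simp [Complex.norm_real, abs_of_pos Real.pi_pos]
    rw [heq, norm_mul, hnorm]
    calc (2 * π)⁻¹ / 2 * ‖(A - 2 * π * c ^ n) - B‖
        ≤ (2 * π)⁻¹ / 2 * (‖A - 2 * π * c ^ n‖ + ‖B‖) := by gcongr; exact norm_sub_le _ _
      _ ≤ (2 * π)⁻¹ / 2 * (2 * π * (‖c‖ ^ (N + 1) / (1 - ‖c‖)) +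
          2 * π * (‖c‖ ^ (N + 1) / (1 - ‖c‖))) := by gcongr
      _ = ‖c‖ ^ (N + 1) / (1 - ‖c‖) := by field_simp; ring
  -- let `N → ∞`
  have hlim : Tendsto (fun N : ℕ => ‖c‖ ^ (N + 1) / (1 - ‖c‖)) atTop (𝓝 0) := by
    have h := (tendsto_pow_atTop_nhds_zero_of_lt_one (norm_nonneg c) hc).comp (tendsto_add_atTop_nat 1)
    simpa using h.div_const (1 - ‖c‖)
  have h0 : ‖-(2 * π : ℂ)⁻¹ * ((A - B) / (2 * I)) - -(c ^ n) / (2 * I)‖ ≤ 0 :=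
    ge_of_tendsto hlim (eventually_atTop.2 ⟨n, hbound⟩)
  exact sub_eq_zero.1 (norm_le_zero_iff.1 h0)

/-! ### Fubini on `(−π, π] × ℝ²` -/

/-- **Uniform bound for the Biot–Savart `L¹` norms on bounded sets.** For a continuous integrable
vorticity `w` and a radius `R`, there is `M` with `∫ ‖w(η) K(ξ − η)‖ dη ≤ M` for all `|ξ| ≤ R`:
near `ξ` use the bound of `w` on `closedBall 0 (R + 1)` and `|x|⁻¹ ∈ L¹(B(0,1))`, away from `ξ`
the kernel is `≤ (2π)⁻¹` and `w ∈ L¹`. [folklore] -/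
theorem exists_bound_integral_norm_smul_biotSavartKernel2D {w : ℝ² → ℝ} (hw : Continuous w)
    (hwi : Integrable w) (R : ℝ) :
    ∃ M : ℝ, ∀ ξ : ℝ², ‖ξ‖ ≤ R → ∫ η, ‖w η • biotSavartKernel2D (ξ - η)‖ ≤ M := by
  obtain ⟨A, hA⟩ := (isCompact_closedBall (0 : ℝ²) (R + 1)).exists_bound_of_continuousOn
    hw.continuousOn
  refine ⟨(2 * π)⁻¹ * (A * (∫ z, indicator (ball (0 : ℝ²) 1) (fun z => ‖z‖⁻¹) z) + ∫ y, |w y|),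
    fun ξ hξ => ?_⟩
  -- pointwise majorant (local version of `norm_biotSavart_integrand_le`)
  have hpt : ∀ y : ℝ², ‖w y • biotSavartKernel2D (ξ - y)‖ ≤ (2 * π)⁻¹ *
      (A * indicator (ball (0 : ℝ²) 1) (fun z => ‖z‖⁻¹) (ξ - y) + |w y|) := by
    intro y
    rw [norm_smul, Real.norm_eq_abs, norm_biotSavartKernel2D, ← mul_assoc, mul_comm |w y|, mul_assoc]
    gcongr
    have h0 : 0 ≤ |w y| := abs_nonneg _
    by_cases hxy : ‖ξ - y‖ < 1
    · rw [indicator_of_mem (mem_ball_zero_iff.2 hxy)]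
      have hyR : y ∈ closedBall (0 : ℝ²) (R + 1) := by
        rw [mem_closedBall, dist_zero_right]
        have := norm_sub_norm_le y ξ
        rw [norm_sub_rev] at hxy
        linarith
      have hAy : |w y| ≤ A := by simpa [Real.norm_eq_abs] using hA y hyR
      have : |w y| * ‖ξ - y‖⁻¹ ≤ A * ‖ξ - y‖⁻¹ := by gcongr
      linarith
    · have h2 : ‖ξ - y‖⁻¹ ≤ 1 := inv_le_one_of_one_le₀ (not_lt.1 hxy)
      rw [indicator_of_notMem (by rwa [mem_ball_zero_iff]), mul_zero, zero_add]
      calc |w y| * ‖ξ - y‖⁻¹ ≤ |w y| * 1 := by gcongr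
        _ = |w y| := mul_one _
  have hint : Integrable fun y => (2 * π)⁻¹ *
      (A * indicator (ball (0 : ℝ²) 1) (fun z => ‖z‖⁻¹) (ξ - y) + |w y|) :=
    (((integrable_indicator_inv_norm.comp_sub_left ξ).const_mul A).add hwi.abs).const_mul _
  refine (integral_mono_of_nonneg (Eventually.of_forall fun y => norm_nonneg _) hint
    (Eventually.of_forall hpt)).trans (le_of_eq ?_)
  rw [integral_const_mul, integral_add ((integrable_indicator_inv_norm.comp_sub_left ξ).const_mul A)
    hwi.abs, integral_const_mul,
    integral_sub_left_eq_self (indicator (ball (0 : ℝ²) 1) fun z => ‖z‖⁻¹) volume ξ]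

/-- The circle × plane integrand `F(θ, η) = e^{-inθ} w(η) ⟪K(ξ_θ − η), ξ_θ⟫` is measurable.
[folklore] -/
theorem measurable_angExp_mul_inner_kernel {w : ℝ² → ℝ} (hw : Continuous w) (r : ℝ) (n : ℤ) :
    Measurable fun p : ℝ × ℝ² => angExp (-n) p.1 * ((w p.2 : ℂ) *
      (⟪biotSavartKernel2D (circlePt r p.1 - p.2), circlePt r p.1⟫ : ℂ)) := by
  have h1 : Measurable fun p : ℝ × ℝ² => angExp (-n) p.1 :=
    ((continuous_angExp (-n)).comp continuous_fst).measurable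
  have h2 : Measurable fun p : ℝ × ℝ² => (w p.2 : ℂ) :=
    (Complex.continuous_ofReal.comp (hw.comp continuous_snd)).measurable
  have h3 : Measurable fun p : ℝ × ℝ² => biotSavartKernel2D (circlePt r p.1 - p.2) :=
    measurable_biotSavartKernel2D.comp
      (((continuous_circlePt r).comp continuous_fst).sub continuous_snd).measurable
  have h4 : Measurable fun p : ℝ × ℝ² => circlePt r p.1 :=
    ((continuous_circlePt r).comp continuous_fst).measurable
  exact h1.mul (h2.mul (Complex.measurable_ofReal.comp (h3.inner h4)))

/-- **Integrability on `(−π, π] × ℝ²`** of `F(θ, η) = e^{-inθ} w(η) ⟪K(ξ_θ − η), ξ_θ⟫` for a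
continuous integrable `w` whose Biot–Savart integrals converge absolutely: `|F| ≤ r ‖w(η)K(ξ_θ−η)‖`,
the `η`-integrals of which are bounded uniformly in `θ`. [folklore] -/
theorem integrable_angExp_mul_inner_kernel {w : ℝ² → ℝ} (hw : Continuous w) (hwi : Integrable w)
    (hK : ∀ ξ, Integrable (fun η => w η • biotSavartKernel2D (ξ - η))) {r : ℝ} (hr : 0 < r)
    (n : ℤ) :
    Integrable (uncurry fun (θ : ℝ) (η : ℝ²) => angExp (-n) θ * ((w η : ℂ) *
      (⟪biotSavartKernel2D (circlePt r θ - η), circlePt r θ⟫ : ℂ)))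
      ((volume.restrict (Ioc (-π) π)).prod volume) := by
  have hmeas := measurable_angExp_mul_inner_kernel hw r n
  have hnorm : ∀ (θ : ℝ) (η : ℝ²), ‖angExp (-n) θ * ((w η : ℂ) *
      (⟪biotSavartKernel2D (circlePt r θ - η), circlePt r θ⟫ : ℂ))‖ ≤
      r * ‖w η • biotSavartKernel2D (circlePt r θ - η)‖ := by
    intro θ η
    rw [norm_mul, norm_angExp, one_mul, norm_mul, Complex.norm_real, Complex.norm_real, norm_smul,
      mul_comm r, mul_assoc]
    gcongr
    calc ‖⟪biotSavartKernel2D (circlePt r θ - η), circlePt r θ⟫‖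
        ≤ ‖biotSavartKernel2D (circlePt r θ - η)‖ * ‖circlePt r θ‖ := norm_inner_le_norm _ _
      _ = ‖biotSavartKernel2D (circlePt r θ - η)‖ * r := by rw [norm_circlePt, abs_of_pos hr]
  obtain ⟨M, hM⟩ := exists_bound_integral_norm_smul_biotSavartKernel2D hw hwi r
  change Integrable (fun p : ℝ × ℝ² => angExp (-n) p.1 * ((w p.2 : ℂ) *
      (⟪biotSavartKernel2D (circlePt r p.1 - p.2), circlePt r p.1⟫ : ℂ))) _
  rw [integrable_prod_iff hmeas.aestronglyMeasurable]
  constructor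
  · refine Eventually.of_forall fun θ => ?_
    exact Integrable.mono' (((hK (circlePt r θ)).norm.const_mul r))
      (hmeas.comp measurable_prodMk_left).aestronglyMeasurable
      (Eventually.of_forall fun η => hnorm θ η)
  · refine Integrable.mono' (integrable_const (r * M))
      hmeas.aestronglyMeasurable.norm.integral_prod_right' (Eventually.of_forall fun θ => ?_)
    rw [Real.norm_of_nonneg (integral_nonneg fun η => norm_nonneg _)]
    calc ∫ η, ‖angExp (-n) θ * ((w η : ℂ) *
          (⟪biotSavartKernel2D (circlePt r θ - η), circlePt r θ⟫ : ℂ))‖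
        ≤ ∫ η, r * ‖w η • biotSavartKernel2D (circlePt r θ - η)‖ :=
          integral_mono_of_nonneg (Eventually.of_forall fun η => norm_nonneg _)
            ((hK _).norm.const_mul r) (Eventually.of_forall fun η => hnorm θ η)
      _ = r * ∫ η, ‖w η • biotSavartKernel2D (circlePt r θ - η)‖ := integral_const_mul _ _
      _ ≤ r * M := by
          gcongr
          exact hM _ (by rw [norm_circlePt, abs_of_pos hr])

/-! ### The angular modes of the radial velocity -/

/-- In polar coordinates the multipole parameter is `c(ρe^{iφ}) = t e^{-iφ}`,
`t = rρ/max(r,ρ)² = min(r,ρ)/max(r,ρ)`. [folklore] -/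
theorem kerParam_circlePt {r : ℝ} (hr : 0 < r) {ρ : ℝ} (hρ : 0 < ρ) (φ : ℝ) :
    kerParam r (circlePt ρ φ) = ((min r ρ / max r ρ : ℝ) : ℂ) * angExp (-1) φ := by
  rw [kerParam, cplx_circlePt_eq_angExp, norm_circlePt, abs_of_pos hρ, map_mul, Complex.conj_ofReal,
    ← angExp_neg, ← mul_div_max_sq_eq_min_div_max hr ρ]
  have : ((max r ρ : ℝ) : ℂ) ≠ 0 := by exact_mod_cast (lt_of_lt_of_le hr (le_max_left _ _)).ne'
  push_cast
  field_simp

/-- The radial velocity as an integral: `⟪(K∗w)(ξ), ξ⟫ = ∫ w(η) ⟪K(ξ − η), ξ⟫ dη` when the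
Biot–Savart integral converges absolutely at `ξ`. [folklore] -/
theorem inner_biotSavart2D_eq_integral {w : ℝ² → ℝ} {ξ : ℝ²}
    (hK : Integrable (fun η => w η • biotSavartKernel2D (ξ - η))) :
    ⟪biotSavart2D w ξ, ξ⟫ = ∫ η, w η * ⟪biotSavartKernel2D (ξ - η), ξ⟫ := by
  rw [biotSavart2D, real_inner_comm, ← integral_inner hK]
  refine integral_congr_ae (Eventually.of_forall fun η => ?_)
  simp only [real_inner_smul_right, real_inner_comm]

/-- **Angular Fourier modes of the radial Biot–Savart velocity.** For a continuous integrable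
planar vorticity `w` whose Biot–Savart integrals converge absolutely, `r > 0` and `n ≥ 1`:

  `(2π)⁻¹ ∫_{-π}^{π} e^{-inθ} ⟪(K∗w)(ξ_θ), ξ_θ⟫ dθ = (i/2) ∫_{(0,∞)} ρ (min(r,ρ)/max(r,ρ))^n ŵ_n(ρ) dρ`,

`ξ_θ = (r cos θ, r sin θ)`, `ŵ_n = angCoeff w · n` — the mode-`n` part of
`ξ·v(ξ) = −(2π)⁻¹ ∫ Σ_m t^m sin m(θ−φ) w(η) dη`. Proof: Fubini
(`integrable_angExp_mul_inner_kernel`), the `θ`-integral for a.e. source point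
(`integral_angExp_mul_inner_kernel`, off the null circle `|η| = r`), and polar coordinates in `η`
(`integral_eq_integral_circlePt`, `kerParam_circlePt`). [folklore] -/
theorem angCoeff_inner_biotSavart2D {w : ℝ² → ℝ} (hw : Continuous w) (hwi : Integrable w)
    (hK : ∀ ξ, Integrable (fun η => w η • biotSavartKernel2D (ξ - η))) {r : ℝ} (hr : 0 < r)
    {n : ℕ} (hn : 1 ≤ n) :
    angCoeff (fun ξ => (⟪biotSavart2D w ξ, ξ⟫ : ℂ)) r n =
      (I / 2) * ∫ ρ in Ioi (0 : ℝ), ((ρ * (min r ρ / max r ρ) ^ n : ℝ) : ℂ) *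
        angCoeff (fun ξ => (w ξ : ℂ)) ρ n := by
  have hπ : -π ≤ π := by linarith [Real.pi_pos]
  have hπ0 : (2 * π : ℂ) ≠ 0 := by exact_mod_cast Real.two_pi_pos.ne'
  have h2I : (2 : ℂ) * I ≠ 0 := mul_ne_zero two_ne_zero Complex.I_ne_zero
  set F : ℝ → ℝ² → ℂ := fun θ η => angExp (-n) θ * ((w η : ℂ) *
    (⟪biotSavartKernel2D (circlePt r θ - η), circlePt r θ⟫ : ℂ)) with hF
  -- Step 1: the coefficient as an iterated integral
  have h1 : angCoeff (fun ξ => (⟪biotSavart2D w ξ, ξ⟫ : ℂ)) r n =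
      (2 * π : ℂ)⁻¹ * ∫ θ in (-π)..π, ∫ η, F θ η := by
    rw [angCoeff]
    congr 1
    refine intervalIntegral.integral_congr fun θ _ => ?_
    simp only [hF]
    have hcast : ((∫ η, w η * ⟪biotSavartKernel2D (circlePt r θ - η), circlePt r θ⟫ : ℝ) : ℂ) =
        ∫ η, ((w η * ⟪biotSavartKernel2D (circlePt r θ - η), circlePt r θ⟫ : ℝ) : ℂ) :=
      integral_ofReal.symm
    rw [inner_biotSavart2D_eq_integral (hK _), hcast, ← integral_const_mul]
    refine integral_congr_ae (Eventually.of_forall fun η => ?_)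
    push_cast
    ring
  -- Step 2: Fubini
  have h2 : (∫ θ in (-π)..π, ∫ η, F θ η) = ∫ η, ∫ θ in (-π)..π, F θ η := by
    apply intervalIntegral_integral_swap
    rw [uIoc_of_le hπ]
    exact integrable_angExp_mul_inner_kernel hw hwi hK hr n
  -- Step 3: the `θ`-integral for a.e. source point
  have h3 : (∫ η, ∫ θ in (-π)..π, F θ η) = ∫ η, (w η : ℂ) * (-(kerParam r η) ^ n / (2 * I)) := by
    refine integral_congr_ae ?_
    have hae : ∀ᵐ η : ℝ² ∂volume, η ∉ sphere (0 : ℝ²) r :=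
      measure_eq_zero_iff_ae_notMem.1 (Measure.addHaar_sphere volume (0 : ℝ²) r)
    filter_upwards [hae] with η hη
    rw [mem_sphere_zero_iff_norm] at hη
    simp only [hF]
    have hcomm : ∀ θ : ℝ, angExp (-n) θ * ((w η : ℂ) *
        (⟪biotSavartKernel2D (circlePt r θ - η), circlePt r θ⟫ : ℂ)) =
        (w η : ℂ) * (angExp (-n) θ *
          (⟪biotSavartKernel2D (circlePt r θ - η), circlePt r θ⟫ : ℂ)) := fun θ => by ring
    simp_rw [hcomm]
    rw [intervalIntegral.integral_const_mul, integral_angExp_mul_inner_kernel hr hη hn]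
  -- Step 4: constants out; polar coordinates in the source point
  have h4 : (∫ η, (w η : ℂ) * (-(kerParam r η) ^ n / (2 * I))) =
      -(1 / (2 * I)) * ∫ η, (w η : ℂ) * kerParam r η ^ n := by
    rw [← integral_const_mul]
    refine integral_congr_ae (Eventually.of_forall fun η => ?_)
    field_simp
  have hgi : Integrable (fun η => (w η : ℂ) * kerParam r η ^ n) := by
    refine Integrable.mono' hwi.norm
      ((Complex.continuous_ofReal.comp hw).mul ((continuous_kerParam hr).pow n)).aestronglyMeasurable
      (Eventually.of_forall fun η => ?_)
    rw [norm_mul, Complex.norm_real, norm_pow]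
    calc ‖w η‖ * ‖kerParam r η‖ ^ n ≤ ‖w η‖ * 1 := by
          gcongr; exact pow_le_one₀ (norm_nonneg _) (norm_kerParam_le_one hr η)
      _ = ‖w η‖ := mul_one _
  have h5 : (∫ η, (w η : ℂ) * kerParam r η ^ n) = ∫ ρ in Ioi (0 : ℝ),
      (2 * π : ℂ) * (((ρ * (min r ρ / max r ρ) ^ n : ℝ) : ℂ) * angCoeff (fun ξ => (w ξ : ℂ)) ρ n) := by
    rw [integral_eq_integral_circlePt hgi]
    refine setIntegral_congr_fun measurableSet_Ioi fun ρ hρ => ?_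
    rw [mem_Ioi] at hρ
    have hin : ∀ φ : ℝ, ρ • ((w (circlePt ρ φ) : ℂ) * kerParam r (circlePt ρ φ) ^ n) =
        ((ρ * (min r ρ / max r ρ) ^ n : ℝ) : ℂ) * (angExp (-n) φ * (w (circlePt ρ φ) : ℂ)) := by
      intro φ
      rw [kerParam_circlePt hr hρ, mul_pow, angExp_pow, Complex.real_smul,
        show ((n : ℕ) : ℤ) * (-1) = -(n : ℤ) by ring]
      push_cast
      ring
    simp_rw [hin]
    rw [integral_const_mul, angCoeff, intervalIntegral.integral_of_le hπ]
    field_simp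
  rw [h1, h2, h3, h4, h5, integral_const_mul]
  have hI : -(1 / (2 * I)) = I / 2 := by
    rw [div_mul_eq_div_div, Complex.div_I]
    ring
  rw [← hI]
  field_simp

end Literature.Analysis.FluidPDE
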